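import Mathlib
import HarnessLib
import Summits.KontsevichZagierPeriods.Zeta5Search.BarnesEulerContinuation

/-!
# ζ(5) search — Nesterenko's Lemma 2 on the cut `0 < z ≤ 1`, both branches `e^{±iπs}` (cell `pub-zeta5`, ct-1 g27)

HONEST FRAMING: systematic search; no irrationality claim unless kernel-certified.  An identity of special functions;
nothing here is an irrationality result, a worthiness exponent or a denominator statement; no named fact is discharged
(the typed `Zudilin2002.vwp_eq_integral_of_pos` stays reduced to its `k ≥ 2` part; debt unchanged).

Last third of brick B2-on-the-cut of `HOME/ct-1/g26/VWP-BLUEPRINT.md`.  Zudilin's Lemma 2 (math/0206177; Nesterenko,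
JTNB 15 (2003) §3.2) on the cut: for real `0 < x ≤ 1`, complex `a₀, a, b` and a real abscissa `t₀` with
`0 < t₀ < Re a₀`, `t₀ < Re a` and the printed `Re b > Re a₀ + Re a`,

  `∫₀¹ t^{a−1}(1−t)^{b−a−1}(1−xt)^{−a₀} dt = Γ(b−a)/Γ(a₀) · (1/2π) ∫_ℝ Γ(a₀+s)Γ(a+s)Γ(−s)/Γ(b+s) · x^{s} e^{iεπs} dy`,

`s = −t₀+iy`, `ε = ±1` (`(−z)^s = z^s e^{±iπs}`, `arg(−z) = ±π` in the printed statement) — `eulerIntegral_pos_eq_barnes`.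
It is the boundary value of ct-1 g27's continued identity `BarnesEulerContinuation.eulerIntegral_neg_eq_barnes_of_mem` along
`w_n = −x(1−r_n) + iεx r_n → −x`, `r_n = 1/(n+1)` (`Im w_n` has the sign of `ε`, `‖w_n‖ ≥ x/2`, `Re w_n > −1`):

* `tendsto_barnes_integral` — dominated convergence on the Barnes side (majorant `‖K(y)‖e^{π|y|}m^{−t₀}` of
  `BarnesKernelBounds.integrable_norm_kernel_mul_exp_pi`; pointwise `w_n^{s} = e^{s log w_n} → e^{s L}` when `log w_n → L`);
* `tendsto_eulerIntegral` — dominated convergence on the Euler side for `z_n → x` with `Re z_n < 1` (majorant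
  `e^{π|Im a₀|} t^{Re a−1}(1−t)^{Re(b−a₀−a)−1}`, from `|1−zt| ≥ 1−t`: `norm_one_sub_mul_cpow_le`);
* `tendsto_log_approach` — `log w_n → log x + iεπ` (`Complex.tendsto_arg_nhdsWithin_im_nonneg/neg_of_re_neg_of_im_zero`);
* `eulerIntegral_pos_eq_barnes` — the identity on the cut; `barnes_exp_eq_Gamma` — its value at `x = 1` in closed form,
  `(1/2π)∫ K(y)e^{iεπs} dy = Γ(a₀)Γ(a)Γ(b−a−a₀)/(Γ(b−a)Γ(b−a₀))` (the inner `t`-integral of Zudilin's (14)).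

Theorems only (no definitions); imports `Zeta5Search/BarnesEulerContinuation`.
-/

noncomputable section

namespace Summit.KontsevichZagierPeriods.Zeta5Search.BarnesEulerIntegralCut

open MeasureTheory Set Filter Metric
open scoped Real Topology
open Literature.Analysis.SpecialFunctions.Hypergeometric (eulerIntegrand eulerIntegral intervalIntegrable_eulerIntegrand
  intervalIntegrable_norm_betaIntegrand)
open Summit.KontsevichZagierPeriods.Zeta5Search.BarnesKernelBounds
open Summit.KontsevichZagierPeriods.Zeta5Search.BarnesEulerContinuation

variable {t₀ : ℝ} {a₀ a b : ℂ}

/-! ### 1. The Barnes side: dominated convergence towards the cut -/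

/-- **Barnes side, limit**: if `‖w_n‖ ≥ m > 0` and `log w_n → L`, then
`∫_ℝ K(y) w_n^{s} dy → ∫_ℝ K(y) e^{L s} dy` (`Re b > Re a₀ + Re a`; dominated by `‖K(y)‖e^{π|y|}m^{−t₀}`). -/
theorem tendsto_barnes_integral (ht₀ : 0 < t₀) (ht₀' : t₀ < a₀.re) (hta : t₀ < a.re) (htb : t₀ < b.re)
    (hb : a₀.re + a.re < b.re) {m : ℝ} (hm : 0 < m) {w : ℕ → ℂ} (hwm : ∀ n, m ≤ ‖w n‖) {L : ℂ}
    (hL : Tendsto (fun n => Complex.log (w n)) atTop (𝓝 L)) :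
    Tendsto (fun n => ∫ y : ℝ,
        Complex.Gamma (a₀ + (-(t₀ : ℂ) + (y : ℂ) * Complex.I)) * Complex.Gamma (a + (-(t₀ : ℂ) + (y : ℂ) * Complex.I)) *
              Complex.Gamma (-(-(t₀ : ℂ) + (y : ℂ) * Complex.I)) /
            Complex.Gamma (b + (-(t₀ : ℂ) + (y : ℂ) * Complex.I)) *
          w n ^ (-(t₀ : ℂ) + (y : ℂ) * Complex.I))
      atTop (𝓝 (∫ y : ℝ,
        Complex.Gamma (a₀ + (-(t₀ : ℂ) + (y : ℂ) * Complex.I)) * Complex.Gamma (a + (-(t₀ : ℂ) + (y : ℂ) * Complex.I)) *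
              Complex.Gamma (-(-(t₀ : ℂ) + (y : ℂ) * Complex.I)) /
            Complex.Gamma (b + (-(t₀ : ℂ) + (y : ℂ) * Complex.I)) *
          Complex.exp (L * (-(t₀ : ℂ) + (y : ℂ) * Complex.I)))) := by
  have hw0 : ∀ n, w n ≠ 0 := fun n => norm_pos_iff.1 (lt_of_lt_of_le hm (hwm n))
  refine tendsto_integral_filter_of_dominated_convergence
    (fun y => ‖Complex.Gamma (a₀ + (-(t₀ : ℂ) + (y : ℂ) * Complex.I)) * Complex.Gamma (a + (-(t₀ : ℂ) + (y : ℂ) * Complex.I)) *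
              Complex.Gamma (-(-(t₀ : ℂ) + (y : ℂ) * Complex.I)) /
            Complex.Gamma (b + (-(t₀ : ℂ) + (y : ℂ) * Complex.I))‖ * Real.exp (π * |y|) * m ^ (-t₀))
    (Eventually.of_forall fun n => (continuous_integrand ht₀ ht₀' hta htb (hw0 n)).aestronglyMeasurable)
    (Eventually.of_forall fun n => Eventually.of_forall fun y => ?_)
    ((integrable_norm_kernel_mul_exp_pi ht₀ ht₀' hta htb hb).mul_const _) (Eventually.of_forall fun y => ?_)
  · have h := norm_cpow_line_le hm (hwm n) (Complex.abs_arg_le_pi _) ht₀.le y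
    rw [norm_mul]
    calc _ ≤ ‖Complex.Gamma (a₀ + (-(t₀ : ℂ) + (y : ℂ) * Complex.I)) * Complex.Gamma (a + (-(t₀ : ℂ) + (y : ℂ) * Complex.I)) *
              Complex.Gamma (-(-(t₀ : ℂ) + (y : ℂ) * Complex.I)) /
            Complex.Gamma (b + (-(t₀ : ℂ) + (y : ℂ) * Complex.I))‖ * (m ^ (-t₀) * Real.exp (π * |y|)) :=
          mul_le_mul_of_nonneg_left h (norm_nonneg _)
      _ = _ := by ring
  · have hcp : ∀ n, w n ^ (-(t₀ : ℂ) + (y : ℂ) * Complex.I) =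
        Complex.exp (Complex.log (w n) * (-(t₀ : ℂ) + (y : ℂ) * Complex.I)) := fun n =>
      Complex.cpow_def_of_ne_zero (hw0 n) _
    simp_rw [hcp]
    exact ((Complex.continuous_exp.tendsto _).comp (hL.mul tendsto_const_nhds)).const_mul _

/-! ### 2. The Euler side: dominated convergence towards the cut -/

/-- For `Re z ≤ 1`, `Re a₀ ≥ 0` and `t ∈ (0,1)`: `‖(1 − zt)^{−a₀}‖ ≤ e^{π|Im a₀|}(1 − t)^{−Re a₀}` (`|1 − zt| ≥ Re(1 − zt) ≥ 1 − t`). -/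
theorem norm_one_sub_mul_cpow_le (ha₀ : 0 ≤ a₀.re) {z : ℂ} (hz : z.re ≤ 1) {t : ℝ} (ht : t ∈ Ioo (0 : ℝ) 1) :
    ‖(1 - z * (t : ℂ)) ^ (-a₀)‖ ≤ Real.exp (π * |a₀.im|) * (1 - t) ^ (-a₀.re) := by
  have ht1 : 0 < 1 - t := by linarith [ht.2]
  have hre : 1 - t ≤ (1 - z * (t : ℂ)).re := by
    have e : (1 - z * (t : ℂ)).re = 1 - z.re * t := by simp [Complex.mul_re]
    rw [e]; nlinarith [ht.1]
  have hnorm : 1 - t ≤ ‖1 - z * (t : ℂ)‖ := le_trans hre (Complex.re_le_norm _)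
  have hu : 1 - z * (t : ℂ) ≠ 0 := norm_pos_iff.1 (lt_of_lt_of_le ht1 hnorm)
  rw [Complex.norm_cpow_of_ne_zero hu, Complex.neg_re, Complex.neg_im, div_eq_mul_inv, ← Real.exp_neg, mul_comm]
  refine mul_le_mul ?_ (Real.rpow_le_rpow_of_nonpos ht1 hnorm (by linarith)) (Real.rpow_nonneg (norm_nonneg _) _)
    (Real.exp_pos _).le
  apply Real.exp_le_exp.2
  calc -(Complex.arg (1 - z * (t : ℂ)) * -a₀.im) = Complex.arg (1 - z * (t : ℂ)) * a₀.im := by ring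
    _ ≤ |Complex.arg (1 - z * (t : ℂ)) * a₀.im| := le_abs_self _
    _ = |Complex.arg (1 - z * (t : ℂ))| * |a₀.im| := abs_mul _ _
    _ ≤ π * |a₀.im| := mul_le_mul_of_nonneg_right (Complex.abs_arg_le_pi _) (abs_nonneg _)

/-- Off the endpoint `t = 1`: almost every real `t` is `≠ 1`. -/
theorem ae_ne_one : ∀ᵐ t : ℝ ∂volume, t ≠ 1 := by
  rw [ae_iff]
  have h : {t : ℝ | ¬ t ≠ 1} = {1} := by ext t; simp
  rw [h, measure_singleton]

/-- **Euler side, limit**: if `z_n → x ∈ (0,1]` with `Re z_n < 1`, then `eulerIntegral a₀ a b z_n → eulerIntegral a₀ a b x`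
(`Re a₀, Re a > 0`, `Re b > Re a₀ + Re a`; dominated by `e^{π|Im a₀|} t^{Re a−1}(1−t)^{Re(b−a₀−a)−1}`). -/
theorem tendsto_eulerIntegral (ha₀ : 0 < a₀.re) (ha : 0 < a.re) (hb : a₀.re + a.re < b.re) {x : ℝ} (hx1 : x ≤ 1)
    {z : ℕ → ℂ} (hz : Tendsto z atTop (𝓝 (x : ℂ))) (hz1 : ∀ n, (z n).re < 1) :
    Tendsto (fun n => eulerIntegral a₀ a b (z n)) atTop (𝓝 (eulerIntegral a₀ a b x)) := by
  have hab : a.re < b.re := by linarith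
  unfold eulerIntegral
  refine intervalIntegral.tendsto_integral_filter_of_dominated_convergence
    (fun t => Real.exp (π * |a₀.im|) * ‖(t : ℂ) ^ (a - 1) * (1 - (t : ℂ)) ^ ((b - a₀) - a - 1)‖)
    (Eventually.of_forall fun n => (intervalIntegrable_eulerIntegrand a₀ ha hab (hz1 n)).def'.aestronglyMeasurable)
    (Eventually.of_forall fun n => ?_) ((intervalIntegrable_norm_betaIntegrand ha (by simp; linarith)).const_mul _) ?_
  · filter_upwards [ae_ne_one] with t ht1 htI
    rw [uIoc_of_le zero_le_one] at htI
    have ht : t ∈ Ioo (0 : ℝ) 1 := ⟨htI.1, lt_of_le_of_ne htI.2 ht1⟩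
    have ht1' : 0 < 1 - t := by linarith [ht.2]
    have hc := norm_one_sub_mul_cpow_le ha₀.le (hz1 n).le ht
    have e1 : ‖(1 - (t : ℂ)) ^ ((b - a₀) - a - 1)‖ = ‖(1 - (t : ℂ)) ^ (b - a - 1)‖ * (1 - t) ^ (-a₀.re) := by
      rw [show (1 : ℂ) - (t : ℂ) = ((1 - t : ℝ) : ℂ) by push_cast; ring,
        Complex.norm_cpow_eq_rpow_re_of_pos ht1', Complex.norm_cpow_eq_rpow_re_of_pos ht1', ← Real.rpow_add ht1']
      congr 1; simp; ring
    unfold eulerIntegrand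
    rw [norm_mul, norm_mul, norm_mul, e1]
    calc ‖(t : ℂ) ^ (a - 1)‖ * ‖(1 - (t : ℂ)) ^ (b - a - 1)‖ * ‖(1 - z n * (t : ℂ)) ^ (-a₀)‖
        ≤ ‖(t : ℂ) ^ (a - 1)‖ * ‖(1 - (t : ℂ)) ^ (b - a - 1)‖ * (Real.exp (π * |a₀.im|) * (1 - t) ^ (-a₀.re)) :=
          mul_le_mul_of_nonneg_left hc (by positivity)
      _ = _ := by ring
  · filter_upwards [ae_ne_one] with t ht1 htI
    rw [uIoc_of_le zero_le_one] at htI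
    have ht : t < 1 := lt_of_le_of_ne htI.2 ht1
    have hslit : (1 : ℂ) - (x : ℂ) * (t : ℂ) ∈ Complex.slitPlane := by
      rw [show (1 : ℂ) - (x : ℂ) * (t : ℂ) = ((1 - x * t : ℝ) : ℂ) by push_cast; ring]
      refine Complex.ofReal_mem_slitPlane.2 ?_
      nlinarith [htI.1]
    have hcont : Tendsto (fun n => (1 - z n * (t : ℂ)) ^ (-a₀)) atTop (𝓝 ((1 - (x : ℂ) * (t : ℂ)) ^ (-a₀))) :=
      ((continuousAt_cpow_const (b := -a₀) hslit).tendsto).comp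
        (tendsto_const_nhds.sub (hz.mul tendsto_const_nhds))
    unfold eulerIntegrand
    exact hcont.const_mul _

/-! ### 3. The approach `w_n → −x` from the side `sign ε` -/

/-- **The logarithm along the approach**: if `w_n → −x` (`x > 0`) with `ε · Im w_n ≥ 0` … precisely, with `Im w_n ≥ 0` for
`ε = 1` and `Im w_n < 0` for `ε = −1`, then `log w_n → log x + iεπ`. -/
theorem tendsto_log_approach {x : ℝ} (hx : 0 < x) {ε : ℝ} (hε : ε = 1 ∨ ε = -1) {w : ℕ → ℂ}
    (hw : Tendsto w atTop (𝓝 (-(x : ℂ)))) (hside : ∀ n, (ε = 1 → 0 ≤ (w n).im) ∧ (ε = -1 → (w n).im < 0)) :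
    Tendsto (fun n => Complex.log (w n)) atTop (𝓝 ((Real.log x : ℂ) + ε * π * Complex.I)) := by
  have hre : (-(x : ℂ)).re < 0 := by simp [hx]
  have him : (-(x : ℂ)).im = 0 := by simp
  -- the modulus
  have hnorm : Tendsto (fun n => Real.log ‖w n‖) atTop (𝓝 (Real.log x)) := by
    have h1 : Tendsto (fun n => ‖w n‖) atTop (𝓝 x) := by
      have := hw.norm
      rwa [norm_neg, Complex.norm_real, Real.norm_eq_abs, abs_of_pos hx] at this
    exact (Real.continuousAt_log hx.ne').tendsto.comp h1
  -- the argument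
  have harg : Tendsto (fun n => Complex.arg (w n)) atTop (𝓝 (ε * π)) := by
    rcases hε with h | h
    · subst h
      have hin : Tendsto w atTop (𝓝[{z : ℂ | 0 ≤ z.im}] (-(x : ℂ))) :=
        tendsto_nhdsWithin_iff.2 ⟨hw, Eventually.of_forall fun n => (hside n).1 rfl⟩
      have := (Complex.tendsto_arg_nhdsWithin_im_nonneg_of_re_neg_of_im_zero hre him).comp hin
      rw [one_mul]
      exact this
    · subst h
      have hin : Tendsto w atTop (𝓝[{z : ℂ | z.im < 0}] (-(x : ℂ))) :=
        tendsto_nhdsWithin_iff.2 ⟨hw, Eventually.of_forall fun n => (hside n).2 rfl⟩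
      have := (Complex.tendsto_arg_nhdsWithin_im_neg_of_re_neg_of_im_zero hre him).comp hin
      rw [neg_one_mul]
      exact this
  have hlog : ∀ n, Complex.log (w n) = ((Real.log ‖w n‖ : ℝ) : ℂ) + ((Complex.arg (w n) : ℝ) : ℂ) * Complex.I := by
    intro n
    apply Complex.ext <;> simp [Complex.log_re, Complex.log_im]
  simp_rw [hlog]
  have h2 : Tendsto (fun n => ((Complex.arg (w n) : ℝ) : ℂ) * Complex.I) atTop (𝓝 (((ε * π : ℝ) : ℂ) * Complex.I)) :=
    ((Complex.continuous_ofReal.tendsto _).comp harg).mul tendsto_const_nhds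
  have h1 : Tendsto (fun n => ((Real.log ‖w n‖ : ℝ) : ℂ)) atTop (𝓝 ((Real.log x : ℝ) : ℂ)) :=
    (Complex.continuous_ofReal.tendsto _).comp hnorm
  have := h1.add h2
  push_cast at this
  exact this

/-! ### 4. Lemma 2 on the cut -/

/-- **Nesterenko's Lemma 2 on the cut** [Zudilin math/0206177, Lemma 2; Nesterenko 2003, §3.2]: for real `0 < x ≤ 1`,
complex `a₀, a, b`, a real `t₀` with `0 < t₀ < Re a₀`, `t₀ < Re a`, `Re a₀ + Re a < Re b`, and a sign `ε = ±1`,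
`eulerIntegral a₀ a b x = ∫₀¹ t^{a−1}(1−t)^{b−a−1}(1−xt)^{−a₀} dt
  = Γ(b−a)/Γ(a₀) · (1/2π) ∫_ℝ Γ(a₀+s)Γ(a+s)Γ(−s)/Γ(b+s) · x^{s} e^{iεπs} dy`, `s = −t₀+iy`
(principal `cpow` of the positive real base `x`; the printed `(−z)^{s}` with `arg(−z) = επ`; both branches hold). -/
theorem eulerIntegral_pos_eq_barnes (ht₀ : 0 < t₀) (ht₀' : t₀ < a₀.re) (hta : t₀ < a.re) (hb : a₀.re + a.re < b.re)
    {x : ℝ} (hx : 0 < x) (hx1 : x ≤ 1) {ε : ℝ} (hε : ε = 1 ∨ ε = -1) :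
    eulerIntegral a₀ a b x =
      Complex.Gamma (b - a) / Complex.Gamma a₀ *
        ((1 / (2 * π) : ℂ) * ∫ y : ℝ,
          Complex.Gamma (a₀ + (-(t₀ : ℂ) + (y : ℂ) * Complex.I)) * Complex.Gamma (a + (-(t₀ : ℂ) + (y : ℂ) * Complex.I)) *
              Complex.Gamma (-(-(t₀ : ℂ) + (y : ℂ) * Complex.I)) /
              Complex.Gamma (b + (-(t₀ : ℂ) + (y : ℂ) * Complex.I)) *
            ((x : ℂ) ^ (-(t₀ : ℂ) + (y : ℂ) * Complex.I) * Complex.exp (ε * π * Complex.I * (-(t₀ : ℂ) + (y : ℂ) * Complex.I)))) := by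
  have ha₀ : 0 < a₀.re := lt_trans ht₀ ht₀'
  have ha : 0 < a.re := lt_trans ht₀ hta
  have hab : a.re < b.re := by linarith
  have htb : t₀ < b.re := lt_trans hta hab
  have hε2 : ε ^ 2 = 1 := by rcases hε with h | h <;> simp [h]
  -- the approach sequence
  set r : ℕ → ℝ := fun n => 1 / ((n : ℝ) + 1) with hr
  set w : ℕ → ℂ := fun n => ((-(x * (1 - r n)) : ℝ) : ℂ) + ((x * ε * r n : ℝ) : ℂ) * Complex.I with hw
  have hr0 : ∀ n, 0 < r n := fun n => by rw [hr]; positivity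
  have hr1 : ∀ n, r n ≤ 1 := fun n => by
    rw [hr]; simp only; rw [div_le_one (by positivity)]; linarith [n.cast_nonneg (α := ℝ)]
  have hwre : ∀ n, (w n).re = -(x * (1 - r n)) := fun n => by simp [hw]
  have hwim : ∀ n, (w n).im = x * ε * r n := fun n => by simp [hw]
  have hr_lim : Tendsto r atTop (𝓝 0) := tendsto_one_div_add_atTop_nhds_zero_nat
  have hw_lim : Tendsto w atTop (𝓝 (-(x : ℂ))) := by
    have h1 : Tendsto (fun n => ((-(x * (1 - r n)) : ℝ) : ℂ)) atTop (𝓝 (((-(x * (1 - 0))) : ℝ) : ℂ)) :=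
      (Complex.continuous_ofReal.tendsto _).comp ((tendsto_const_nhds.sub hr_lim).const_mul x).neg
    have h2 : Tendsto (fun n => ((x * ε * r n : ℝ) : ℂ) * Complex.I) atTop (𝓝 (((x * ε * 0 : ℝ) : ℂ) * Complex.I)) :=
      ((Complex.continuous_ofReal.tendsto _).comp (hr_lim.const_mul (x * ε))).mul tendsto_const_nhds
    have := h1.add h2
    simpa [hw] using this
  have hwnorm : ∀ n, x / 2 ≤ ‖w n‖ := by
    intro n
    have hsq : (x / 2) ^ 2 ≤ ‖w n‖ ^ 2 := by
      rw [Complex.sq_norm, Complex.normSq_apply, hwre, hwim]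
      have key : -(x * (1 - r n)) * -(x * (1 - r n)) + x * ε * r n * (x * ε * r n) =
          x ^ 2 * ((1 - r n) ^ 2 + ε ^ 2 * r n ^ 2) := by ring
      have h2 : 1 / 2 ≤ (1 - r n) ^ 2 + ε ^ 2 * r n ^ 2 := by
        rw [hε2]; nlinarith [sq_nonneg (r n - 1 / 2)]
      rw [key]
      nlinarith [mul_le_mul_of_nonneg_left h2 (sq_nonneg x)]
    exact (pow_le_pow_iff_left₀ (by positivity) (norm_nonneg _) two_ne_zero).1 hsq
  have hwslit : ∀ n, w n ∈ Complex.slitPlane := fun n => by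
    refine Complex.mem_slitPlane_iff.2 (Or.inr ?_)
    rw [hwim]
    have : ε ≠ 0 := by rcases hε with h | h <;> simp [h]
    exact mul_ne_zero (mul_ne_zero hx.ne' this) (hr0 n).ne'
  have hwre' : ∀ n, -1 < (w n).re := fun n => by
    rw [hwre]; nlinarith [hr0 n, hr1 n, hx, hx1]
  have hside : ∀ n, (ε = 1 → 0 ≤ (w n).im) ∧ (ε = -1 → (w n).im < 0) := fun n => by
    refine ⟨fun h => ?_, fun h => ?_⟩ <;> rw [hwim, h]
    · positivity
    · have := mul_pos hx (hr0 n); linarith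
  -- the identity along the sequence
  have hid : ∀ n, eulerIntegral a₀ a b (-(w n)) =
      Complex.Gamma (b - a) / Complex.Gamma a₀ *
        ((1 / (2 * π) : ℂ) * ∫ y : ℝ,
          Complex.Gamma (a₀ + (-(t₀ : ℂ) + (y : ℂ) * Complex.I)) * Complex.Gamma (a + (-(t₀ : ℂ) + (y : ℂ) * Complex.I)) *
              Complex.Gamma (-(-(t₀ : ℂ) + (y : ℂ) * Complex.I)) /
              Complex.Gamma (b + (-(t₀ : ℂ) + (y : ℂ) * Complex.I)) *
            w n ^ (-(t₀ : ℂ) + (y : ℂ) * Complex.I)) := fun n =>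
    eulerIntegral_neg_eq_barnes_of_mem ht₀ ht₀' hta hab (hwslit n) (hwre' n)
  -- the two limits
  have hE : Tendsto (fun n => eulerIntegral a₀ a b (-(w n))) atTop (𝓝 (eulerIntegral a₀ a b x)) := by
    refine tendsto_eulerIntegral ha₀ ha hb hx1 (by simpa using hw_lim.neg) fun n => ?_
    simp only [Complex.neg_re, hwre, neg_neg]
    nlinarith [hr0 n, hx]
  set L : ℂ := (Real.log x : ℂ) + ε * π * Complex.I with hL
  have hlog : Tendsto (fun n => Complex.log (w n)) atTop (𝓝 L) := tendsto_log_approach hx hε hw_lim hside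
  have hB := ((tendsto_barnes_integral ht₀ ht₀' hta htb hb (by positivity : 0 < x / 2) hwnorm hlog).const_mul
    ((1 / (2 * π) : ℂ))).const_mul (Complex.Gamma (b - a) / Complex.Gamma a₀)
  have heq := tendsto_nhds_unique hE (by simpa only [hid] using hB)
  have hxc : (x : ℂ) ≠ 0 := by exact_mod_cast hx.ne'
  have hint : (∫ y : ℝ,
        Complex.Gamma (a₀ + (-(t₀ : ℂ) + (y : ℂ) * Complex.I)) * Complex.Gamma (a + (-(t₀ : ℂ) + (y : ℂ) * Complex.I)) *
              Complex.Gamma (-(-(t₀ : ℂ) + (y : ℂ) * Complex.I)) /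
            Complex.Gamma (b + (-(t₀ : ℂ) + (y : ℂ) * Complex.I)) *
          Complex.exp (L * (-(t₀ : ℂ) + (y : ℂ) * Complex.I))) =
      ∫ y : ℝ,
        Complex.Gamma (a₀ + (-(t₀ : ℂ) + (y : ℂ) * Complex.I)) * Complex.Gamma (a + (-(t₀ : ℂ) + (y : ℂ) * Complex.I)) *
              Complex.Gamma (-(-(t₀ : ℂ) + (y : ℂ) * Complex.I)) /
            Complex.Gamma (b + (-(t₀ : ℂ) + (y : ℂ) * Complex.I)) *
          ((x : ℂ) ^ (-(t₀ : ℂ) + (y : ℂ) * Complex.I) *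
            Complex.exp (ε * π * Complex.I * (-(t₀ : ℂ) + (y : ℂ) * Complex.I))) := by
    refine integral_congr_ae (Eventually.of_forall fun y => ?_)
    simp only
    rw [Complex.cpow_def_of_ne_zero hxc, ← Complex.ofReal_log hx.le, ← Complex.exp_add, hL]
    congr 2
    ring
  rw [heq, hint]

/-- **The Barnes integral at `z = 1` in closed form** (the inner `t`-integral of Zudilin's (14)): for complex `a₀, a, b`,
real `0 < t₀ < Re a₀`, `t₀ < Re a`, `Re a₀ + Re a < Re b` and `ε = ±1`,
`(1/2π) ∫_ℝ Γ(a₀+s)Γ(a+s)Γ(−s)/Γ(b+s) e^{iεπs} dy = Γ(a₀)Γ(a)Γ(b−a−a₀)/(Γ(b−a)Γ(b−a₀))`, `s = −t₀+iy`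
(Lemma 2 at `x = 1`, where the Euler integral is the Beta integral `B(a, b−a−a₀)`). -/
theorem barnes_exp_eq_Gamma (ht₀ : 0 < t₀) (ht₀' : t₀ < a₀.re) (hta : t₀ < a.re) (hb : a₀.re + a.re < b.re)
    {ε : ℝ} (hε : ε = 1 ∨ ε = -1) :
    (1 / (2 * π) : ℂ) * ∫ y : ℝ,
        Complex.Gamma (a₀ + (-(t₀ : ℂ) + (y : ℂ) * Complex.I)) * Complex.Gamma (a + (-(t₀ : ℂ) + (y : ℂ) * Complex.I)) *
            Complex.Gamma (-(-(t₀ : ℂ) + (y : ℂ) * Complex.I)) /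
            Complex.Gamma (b + (-(t₀ : ℂ) + (y : ℂ) * Complex.I)) *
          Complex.exp (ε * π * Complex.I * (-(t₀ : ℂ) + (y : ℂ) * Complex.I)) =
      Complex.Gamma a₀ * Complex.Gamma a * Complex.Gamma (b - a - a₀) / (Complex.Gamma (b - a) * Complex.Gamma (b - a₀)) := by
  have ha₀ : 0 < a₀.re := lt_trans ht₀ ht₀'
  have ha : 0 < a.re := lt_trans ht₀ hta
  have h := eulerIntegral_pos_eq_barnes ht₀ ht₀' hta hb one_pos le_rfl hε
  simp only [Complex.ofReal_one, Complex.one_cpow, one_mul] at h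
  -- the Euler integral at `x = 1` is a Beta integral
  have hE : eulerIntegral a₀ a b 1 = Complex.Gamma a * Complex.Gamma (b - a - a₀) / Complex.Gamma (b - a₀) := by
    unfold eulerIntegral
    rw [intervalIntegral.integral_of_le zero_le_one, integral_Ioc_eq_integral_Ioo]
    have hpt : ∀ t ∈ Ioo (0 : ℝ) 1, eulerIntegrand a₀ a b 1 t = (t : ℂ) ^ (a - 1) * (1 - (t : ℂ)) ^ ((b - a - a₀) - 1) := by
      intro t ht
      have ht1 : (1 : ℂ) - (t : ℂ) ≠ 0 := by
        rw [show (1 : ℂ) - (t : ℂ) = ((1 - t : ℝ) : ℂ) by push_cast; ring]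
        exact_mod_cast (by linarith [ht.2] : (1 - t : ℝ) ≠ 0)
      unfold eulerIntegrand
      rw [one_mul, mul_assoc, ← Complex.cpow_add _ _ ht1]
      congr 2; ring
    rw [setIntegral_congr_fun measurableSet_Ioo hpt,
      BarnesCube.integral_beta_Ioo (u := a) (v := b - a - a₀) ha (by simp; linarith)]
    congr 2; ring
  have hc : Complex.Gamma (b - a) / Complex.Gamma a₀ ≠ 0 :=
    div_ne_zero (Complex.Gamma_ne_zero_of_re_pos (by simp; linarith)) (Complex.Gamma_ne_zero_of_re_pos ha₀)
  have hΓ₁ : Complex.Gamma (b - a) ≠ 0 := Complex.Gamma_ne_zero_of_re_pos (by simp; linarith)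
  have hΓ₂ : Complex.Gamma a₀ ≠ 0 := Complex.Gamma_ne_zero_of_re_pos ha₀
  have hΓ₃ : Complex.Gamma (b - a₀) ≠ 0 := Complex.Gamma_ne_zero_of_re_pos (by simp; linarith)
  rw [hE] at h
  rw [← mul_right_inj' hc, ← h]
  field_simp

end Summit.KontsevichZagierPeriods.Zeta5Search.BarnesEulerIntegralCut

end
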